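import Mathlib
import Literature.MathematicalPhysics.MHD.SolovevFluxSurfaceTransport
import Literature.MathematicalPhysics.MHD.SolovevFluxSurfaceGGJData
import HarnessLib

/-!
# Surface-averaged force balance on the Lee–Cerfon / PCF Solov'ev family: `dI/dΨ = C_s V′/(2π)`, hence
# the GGJ data `lcGGJData` are `IsForceBalanced` and Jardin's (8.134) criterion is label-independent
# for them IN THE KERNEL (proved)

Ninth file of the `lcLoop` series (gridfusion-model-5). From the pointwise transport identity of
`SolovevFluxSurfaceTransport.lean` (`∂_r f = C_sκrR₀²/√u + ∂_t H`, `∫₀^{2π} ∂_t H dt = 0`) and dominated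
differentiation under the integral (Mathlib `intervalIntegral.hasDerivAt_integral_of_dominated_loc_of_deriv_le`,
uniform bound by CONTINUITY ON A COMPACT label × angle rectangle):

* `hasDerivAt_toroidalCurrentE_lcLoop` — for `Ψ = psiLC κ F_B R₀ q₀ a` [Lee–Cerfon 2015 §4.1, bib
  `LeeCerfon2015`], the toroidal current within the surface `r`, `I(r) = toroidalCurrentE μ₀ Ψ (lcLoop R₀ κ r) (2π)`
  (Freidberg (6.27) `μ₀I = ∮B_p dℓ`), is differentiable in the label with
  `dI/dr = (C_s/μ₀)·2cR₀²r·∫₀^{2π} w dt` (`w = lcAvgWeight`, `C_s = csLC`, `c = κF_B/(2R₀³q₀)`): since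
  `V′ = 2π∫w` and `dΨ_s/dr = 2cR₀²r` this is `μ₀ dI/dΨ = C_s V′/(2π) = ∮ (Δ*Ψ/R) dℓ/|∇Ψ|` — the
  differentiated form of `μ₀I(Ψ) = ∬_{Ψ' < Ψ} (Δ*Ψ/R) dR dZ` with `Δ*Ψ = C_sR²`;
* `lcGGJData_I'` — the `I′` field of the GGJ record (Jardin (5.34), `μ₀ = 1`, label `Ψ`) equals
  `C_s ∫₀^{2π} w dt = C_s V′/(2π)`;
* **`lcGGJData_isForceBalanced`** — `p′V′ + I′Ψ′ − K′Φ′ = 0` (`p′ = −C_s`, `Ψ′ = 2π`, `K′ = 0`):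
  gridfusion-lit-3's `Mercier.FluxForm.SurfaceData.IsForceBalanced` (Zheng (1.25) / Kruskal–Kulsrud) HOLDS
  for every surface of the family — so by lit-3's `mercierCriterion_relabel_iff` the Mercier criterion of
  these data is the same in every surface label (`mercierCriterion_lcGGJData_relabel_iff`).

HONEST FRAMING: exact real analysis about MODEL objects (ideal MHD, Solov'ev profiles, analytic fixed
boundary); nothing here is a stability claim. Typer/prover: gridfusion-model-5 (g3), 2026-08-27.
-/

noncomputable section

namespace Literature.MathematicalPhysics.MHD.Solovev

open GradShafranov FluxGeometry Mercier.FluxForm _root_.Real MeasureTheory intervalIntegral _root_.Set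
  _root_.Filter _root_.Metric
open scoped _root_.Topology

/-! ## Continuity and a uniform bound for `∂_r f` -/

/-- Joint continuity of `(r, t) ↦ ∂_r f` wherever `u > 0`. [cite: Freidberg2014, §6.3.3 eq. (6.27)] -/
theorem continuousAt_lcCurrentDr {κ FB R₀ q₀ : ℝ} (hκ : 0 < κ) (hFB : 0 < FB) (hR₀ : 0 < R₀)
    (hq₀ : 0 < q₀) (p : ℝ × ℝ) (hp : 0 < lcU R₀ p.1 p.2) :
    ContinuousAt (fun p : ℝ × ℝ => lcCurrentDr κ FB R₀ q₀ p.1 p.2) p := by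
  have hcU : Continuous (fun p : ℝ × ℝ => lcU R₀ p.1 p.2) := by unfold lcU; fun_prop
  have hs : 0 < Real.sqrt (lcU R₀ p.1 p.2) := Real.sqrt_pos.2 hp
  have hc : 0 < κ * FB / (2 * R₀ ^ 3 * q₀) := by positivity
  unfold lcCurrentDr lcGradSqDr lcGradSq lcQKernelDr
  fun_prop (disch := positivity)

/-- Continuity of `t ↦ f(r, t)` on every surface `0 ≤ r < R₀/2`. [cite: Freidberg2014, §6.3.3 eq. (6.27)] -/
theorem continuous_lcCurrentDensity {R₀ κ FB q₀ r : ℝ} (hR₀ : 0 < R₀) (hκ : 0 < κ) (hFB : 0 < FB)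
    (hq₀ : 0 < q₀) (hr : 0 ≤ r) (h2r : 2 * r < R₀) :
    Continuous fun t => lcCurrentDensity κ FB R₀ q₀ r t := by
  have hcU : Continuous (fun t => lcU R₀ r t) := by unfold lcU; fun_prop
  have hpos : ∀ t, 0 < lcU R₀ r t := lcU_pos hR₀ hr h2r
  have hc : 0 < κ * FB / (2 * R₀ ^ 3 * q₀) := by positivity
  rw [continuous_iff_continuousAt]
  intro t
  have hu := hpos t
  have hs : 0 < Real.sqrt (lcU R₀ r t) := Real.sqrt_pos.2 hu
  unfold lcCurrentDensity lcGradSq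
  fun_prop (disch := positivity)

/-- Continuity of `t ↦ ∂_r f(r, t)` on every surface `0 ≤ r < R₀/2`. [cite: Freidberg2014, §6.3.3 eq. (6.27)] -/
theorem continuous_lcCurrentDr {R₀ κ FB q₀ r : ℝ} (hR₀ : 0 < R₀) (hκ : 0 < κ) (hFB : 0 < FB)
    (hq₀ : 0 < q₀) (hr : 0 ≤ r) (h2r : 2 * r < R₀) :
    Continuous fun t => lcCurrentDr κ FB R₀ q₀ r t := by
  rw [continuous_iff_continuousAt]
  intro t
  have h := continuousAt_lcCurrentDr hκ hFB hR₀ hq₀ (r, t) (lcU_pos hR₀ hr h2r t)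
  exact h.comp (f := fun τ : ℝ => (r, τ)) (by fun_prop)

/-- The label neighbourhood `(r/2, (2r+R₀)/4) ∋ r` of admissible labels, inside the compact
`[r/2, (2r+R₀)/4]`. [folklore] -/
private theorem fb_nhds {R₀ r : ℝ} (hr : 0 < r) (h2r : 2 * r < R₀) :
    Ioo (r / 2) ((2 * r + R₀) / 4) ∈ 𝓝 r ∧
      ∀ x ∈ Icc (r / 2) ((2 * r + R₀) / 4), 0 < x ∧ 2 * x < R₀ :=
  ⟨Ioo_mem_nhds (by linarith) (by linarith),
    fun x hx => ⟨by linarith [hx.1], by linarith [hx.2]⟩⟩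

/-- A UNIFORM bound of `|∂_r f|` on the compact label × angle rectangle (continuity on a compact set).
[folklore] -/
private theorem fb_bound {R₀ κ FB q₀ r : ℝ} (hR₀ : 0 < R₀) (hκ : 0 < κ) (hFB : 0 < FB)
    (hq₀ : 0 < q₀) (hr : 0 < r) (h2r : 2 * r < R₀) :
    ∃ C, ∀ x ∈ Icc (r / 2) ((2 * r + R₀) / 4), ∀ t ∈ Icc (0 : ℝ) (2 * π),
      |lcCurrentDr κ FB R₀ q₀ x t| ≤ C := by
  have hK : IsCompact (Icc (r / 2) ((2 * r + R₀) / 4) ×ˢ Icc (0 : ℝ) (2 * π)) :=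
    isCompact_Icc.prod isCompact_Icc
  have hcont : ContinuousOn (fun p : ℝ × ℝ => lcCurrentDr κ FB R₀ q₀ p.1 p.2)
      (Icc (r / 2) ((2 * r + R₀) / 4) ×ˢ Icc (0 : ℝ) (2 * π)) := by
    intro p hp
    obtain ⟨hx0, h2x⟩ := (fb_nhds hr h2r).2 p.1 hp.1
    exact (continuousAt_lcCurrentDr hκ hFB hR₀ hq₀ p (lcU_pos hR₀ hx0.le h2x p.2)).continuousWithinAt
  obtain ⟨C, hC⟩ := hK.exists_bound_of_continuousOn hcont
  refine ⟨C, fun x hx t ht => ?_⟩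
  have h := hC (x, t) ⟨hx, ht⟩
  rwa [Real.norm_eq_abs] at h

/-! ## `dI/dr` -/

/-- `∫₀^{2π} ∂_r f dt = C_s·2cR₀²r·∫₀^{2π} w dt` (transport identity integrated; `κ/√u = 2c·w`).
[cite: Freidberg2014, §6.3.3 eq. (6.27)] -/
theorem integral_lcCurrentDr {R₀ κ FB q₀ r : ℝ} (hR₀ : 0 < R₀) (hκ : 0 < κ) (hFB : 0 < FB)
    (hq₀ : 0 < q₀) (hr : 0 < r) (h2r : 2 * r < R₀) :
    ∫ t in (0 : ℝ)..(2 * π), lcCurrentDr κ FB R₀ q₀ r t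
      = csLC κ FB R₀ q₀ * (2 * (κ * FB / (2 * R₀ ^ 3 * q₀)) * R₀ ^ 2 * r)
          * ∫ t in (0 : ℝ)..(2 * π), lcAvgWeight κ FB R₀ q₀ r t := by
  have hc : 0 < κ * FB / (2 * R₀ ^ 3 * q₀) := by positivity
  have hD := continuous_lcCurrentDr hR₀ hκ hFB hq₀ hr.le h2r
  have hT : Continuous fun t => csLC κ FB R₀ q₀ * (κ * r * R₀ ^ 2 / Real.sqrt (lcU R₀ r t)) := by
    have hcU : Continuous (fun t => lcU R₀ r t) := by unfold lcU; fun_prop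
    exact continuous_const.mul ((continuous_const).div hcU.sqrt
      fun t => (Real.sqrt_pos.2 (lcU_pos hR₀ hr.le h2r t)).ne')
  have hsub := intervalIntegral.integral_sub (μ := volume) (a := (0 : ℝ)) (b := 2 * π)
    (f := fun t => lcCurrentDr κ FB R₀ q₀ r t)
    (g := fun t => csLC κ FB R₀ q₀ * (κ * r * R₀ ^ 2 / Real.sqrt (lcU R₀ r t)))
    (hD.intervalIntegrable _ _) (hT.intervalIntegrable _ _)
  rw [integral_lcCurrentDr_sub hR₀ hκ hFB hq₀ hr h2r] at hsub
  have hpt : ∀ t, csLC κ FB R₀ q₀ * (κ * r * R₀ ^ 2 / Real.sqrt (lcU R₀ r t))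
      = csLC κ FB R₀ q₀ * (2 * (κ * FB / (2 * R₀ ^ 3 * q₀)) * R₀ ^ 2 * r)
          * lcAvgWeight κ FB R₀ q₀ r t := fun t => by
    have hs : 0 < Real.sqrt (lcU R₀ r t) := Real.sqrt_pos.2 (lcU_pos hR₀ hr.le h2r t)
    unfold lcAvgWeight
    field_simp
  have hT' : ∫ t in (0 : ℝ)..(2 * π), csLC κ FB R₀ q₀ * (κ * r * R₀ ^ 2 / Real.sqrt (lcU R₀ r t))
      = csLC κ FB R₀ q₀ * (2 * (κ * FB / (2 * R₀ ^ 3 * q₀)) * R₀ ^ 2 * r)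
          * ∫ t in (0 : ℝ)..(2 * π), lcAvgWeight κ FB R₀ q₀ r t := by
    rw [← intervalIntegral.integral_const_mul]
    exact intervalIntegral.integral_congr fun t _ => hpt t
  linarith

/-- **`dI/dr` on the family:** the toroidal current within the surface `r` (Freidberg (6.27),
`toroidalCurrentE`, any `μ₀`) is differentiable in the label with
`dI/dr = (C_s/μ₀)·2cR₀²r·∫₀^{2π} w dt`, i.e. `μ₀ dI/dΨ = C_sV′/(2π)` (`V′ = 2π∫w`, `dΨ_s/dr = 2cR₀²r`).
[cite: Freidberg2014, §6.3.3 eq. (6.27)] -/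
theorem hasDerivAt_toroidalCurrentE_lcLoop {R₀ κ FB q₀ r : ℝ} (hR₀ : 0 < R₀) (hκ : 0 < κ)
    (hFB : 0 < FB) (hq₀ : 0 < q₀) (hr : 0 < r) (h2r : 2 * r < R₀) (μ0 a : ℝ) :
    HasDerivAt (fun ρ => toroidalCurrentE μ0 (psiLC κ FB R₀ q₀ a) (lcLoop R₀ κ ρ) (2 * π))
      (csLC κ FB R₀ q₀ * (2 * (κ * FB / (2 * R₀ ^ 3 * q₀)) * R₀ ^ 2 * r)
          * (∫ t in (0 : ℝ)..(2 * π), lcAvgWeight κ FB R₀ q₀ r t) / μ0) r := by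
  obtain ⟨hs, hsub⟩ := fb_nhds hr h2r
  obtain ⟨Cb, hCb⟩ := fb_bound hR₀ hκ hFB hq₀ hr h2r
  have hIoo : Ioo (r / 2) ((2 * r + R₀) / 4) ⊆ Icc (r / 2) ((2 * r + R₀) / 4) := Ioo_subset_Icc_self
  have key := intervalIntegral.hasDerivAt_integral_of_dominated_loc_of_deriv_le
    (μ := volume) (a := (0 : ℝ)) (b := 2 * π) (F := fun ρ t => lcCurrentDensity κ FB R₀ q₀ ρ t)
    (F' := fun ρ t => lcCurrentDr κ FB R₀ q₀ ρ t) (x₀ := r) (bound := fun _ => Cb) hs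
    (Filter.eventually_of_mem hs fun x hx =>
      ((continuous_lcCurrentDensity hR₀ hκ hFB hq₀ (hsub x (hIoo hx)).1.le
        (hsub x (hIoo hx)).2).aestronglyMeasurable).restrict)
    ((continuous_lcCurrentDensity hR₀ hκ hFB hq₀ hr.le h2r).intervalIntegrable _ _)
    ((continuous_lcCurrentDr hR₀ hκ hFB hq₀ hr.le h2r).aestronglyMeasurable.restrict)
    (Filter.Eventually.of_forall fun t ht x hx => by
      rw [Real.norm_eq_abs]
      have ht' : t ∈ Icc (0 : ℝ) (2 * π) := by
        rw [uIoc_of_le (by positivity : (0 : ℝ) ≤ 2 * π)] at ht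
        exact ⟨ht.1.le, ht.2⟩
      exact hCb x (hIoo hx) t ht')
    intervalIntegrable_const
    (Filter.Eventually.of_forall fun t _ x hx =>
      hasDerivAt_lcCurrentDensity
        (lcU_pos hR₀ (hsub x (hIoo hx)).1.le (hsub x (hIoo hx)).2 t))
  have hev : (fun ρ => toroidalCurrentE μ0 (psiLC κ FB R₀ q₀ a) (lcLoop R₀ κ ρ) (2 * π))
      =ᶠ[𝓝 r] fun ρ => (∫ t in (0 : ℝ)..(2 * π), lcCurrentDensity κ FB R₀ q₀ ρ t) / μ0 :=
    Filter.eventually_of_mem hs fun x hx => by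
      beta_reduce
      rw [toroidalCurrentE_lcLoop hR₀ hκ hFB hq₀ (hsub x (hIoo hx)).1 (hsub x (hIoo hx)).2 μ0 a]
      rfl
  have h := (key.2.div_const μ0).congr_of_eventuallyEq hev
  rwa [integral_lcCurrentDr hR₀ hκ hFB hq₀ hr h2r] at h

/-! ## The `I′` field of the GGJ record and force balance -/

section data

variable {R₀ κ FB q₀ r : ℝ} (hR₀ : 0 < R₀) (hκ : 0 < κ) (hFB : 0 < FB) (hq₀ : 0 < q₀)
  (hr : 0 < r) (h2r : 2 * r < R₀)
include hR₀ hκ hFB hq₀ hr h2r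

/-- `r ↦` Jardin's toroidal current (5.34) (`μ₀ = 1`) has derivative `C_s·2cR₀²r·∫₀^{2π} w dt`.
[cite: Jardin2010, §5.3 eq. (5.34)] -/
theorem hasDerivAt_toroidalCurrentJ_lcLoop (a : ℝ) :
    HasDerivAt (fun ρ => toroidalCurrentJ 1 (psiLC κ FB R₀ q₀ a) (lcLoop R₀ κ ρ) (2 * π))
      (csLC κ FB R₀ q₀ * (2 * (κ * FB / (2 * R₀ ^ 3 * q₀)) * R₀ ^ 2 * r)
          * ∫ t in (0 : ℝ)..(2 * π), lcAvgWeight κ FB R₀ q₀ r t) r := by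
  have hs : Ioo 0 (R₀ / 2) ∈ 𝓝 r := Ioo_mem_nhds hr (by linarith)
  have hev : (fun ρ => toroidalCurrentJ 1 (psiLC κ FB R₀ q₀ a) (lcLoop R₀ κ ρ) (2 * π))
      =ᶠ[𝓝 r] fun ρ => toroidalCurrentE 1 (psiLC κ FB R₀ q₀ a) (lcLoop R₀ κ ρ) (2 * π) :=
    Filter.eventually_of_mem hs fun x hx =>
      toroidalCurrentJ_eq_toroidalCurrentE
        (volumeDerivE_lcLoop_pos hR₀ hκ hFB hq₀ hx.1 (by linarith [hx.2]) a).ne' 1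
  have h := hasDerivAt_toroidalCurrentE_lcLoop hR₀ hκ hFB hq₀ hr h2r 1 a
  rw [div_one] at h
  exact h.congr_of_eventuallyEq hev

/-- **`I′ = C_s ∫₀^{2π} w dt`** for the GGJ record of the surface. [cite: Jardin2010, §8.5.4 eq. (8.134)] -/
theorem lcGGJData_I' (a g : ℝ) :
    (lcGGJData κ FB R₀ q₀ a g r).I'
      = csLC κ FB R₀ q₀ * ∫ t in (0 : ℝ)..(2 * π), lcAvgWeight κ FB R₀ q₀ r t := by
  have hc : κ * FB / (2 * R₀ ^ 3 * q₀) ≠ 0 := by positivity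
  have h := hasDerivAt_comp_lcRadius (a := a) hc hR₀.ne' hr
    (hasDerivAt_toroidalCurrentJ_lcLoop hR₀ hκ hFB hq₀ hr h2r a)
  have e := h.deriv
  show deriv _ _ = _
  unfold lcRadius lcLabel
  rw [e]
  field_simp

/-- `I′ = C_sV′/(2π)`. [cite: Jardin2010, §8.5.4 eq. (8.134)] -/
theorem lcGGJData_I'_eq (a g : ℝ) :
    (lcGGJData κ FB R₀ q₀ a g r).I' = csLC κ FB R₀ q₀ * (lcGGJData κ FB R₀ q₀ a g r).V' / (2 * π) := by
  rw [lcGGJData_I' hR₀ hκ hFB hq₀ hr h2r, lcGGJData_V' hR₀ hκ hFB hq₀ hr h2r]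
  have hπ : (π : ℝ) ≠ 0 := Real.pi_ne_zero
  field_simp

/-- **SURFACE-AVERAGED FORCE BALANCE HOLDS on every Lee–Cerfon / PCF surface:**
`p′V′ + I′Ψ′ − K′Φ′ = 0` for `lcGGJData` (`p′ = −C_s`, `Ψ′ = 2π`, `K′ = 0`, `I′ = C_sV′/(2π)`).
[cite: Jardin2010, §8.5.4 eq. (8.134)] -/
theorem lcGGJData_isForceBalanced (a g : ℝ) : (lcGGJData κ FB R₀ q₀ a g r).IsForceBalanced := by
  unfold SurfaceData.IsForceBalanced
  rw [lcGGJData_I'_eq hR₀ hκ hFB hq₀ hr h2r]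
  simp only [lcGGJData]
  have hπ : (π : ℝ) ≠ 0 := Real.pi_ne_zero
  field_simp
  ring

/-- Hence Jardin's criterion for these data is LABEL-INDEPENDENT in the kernel: for any relabelling
`ψ̃ = h(ψ)` with `h′ = h1 ≠ 0`, `h″ = h2`, `(relabel).MercierCriterion ↔ MercierCriterion`
(gridfusion-lit-3's `mercierCriterion_relabel_iff`, whose force-balance hypothesis is now discharged).
[cite: Jardin2010, §8.5.4 eq. (8.134)] -/
theorem mercierCriterion_lcGGJData_relabel_iff (a g h1 h2 : ℝ) (hh : h1 ≠ 0) :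
    ((lcGGJData κ FB R₀ q₀ a g r).relabel h1 h2).MercierCriterion
      ↔ (lcGGJData κ FB R₀ q₀ a g r).MercierCriterion :=
  SurfaceData.mercierCriterion_relabel_iff _ h1 h2 hh (lcGGJData_V'_ne hR₀ hκ hFB hq₀ hr h2r a g)
    (lcGGJData_isForceBalanced hR₀ hκ hFB hq₀ hr h2r a g)

end data

end Literature.MathematicalPhysics.MHD.Solovev
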